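import Mathlib
import HarnessLib

/-!
# Commutators in the normalizer of a cyclic subgroup; extraction of a 3-cycle

Topic `Literature/GroupTheory/PermutationGroups`.  Fully PROVED folklore lemmas used in the proof
of Jordan's `p`-cycle theorem (`JordanPrimeCycle.lean`):

* `commute_commutator_of_mem_normalizer_zpowers` — if `a, b` normalize `⟨g⟩` then `[a, b]`
  commutes with `g` (conjugation acts on `⟨g⟩` through commuting power maps).
* `exists_zpow_eq_on_support_of_commute` — a permutation commuting with a cycle `g` acts on
  `supp g` as a power of `g`.
* `swap_commutator_mem_of_commute`, `isThreeCycle_swap_commutator` — if moreover it agrees with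
  `T = (δ₁ δ₂)(δ₁ δ₃)(δ₁ δ₂)(δ₁ δ₃)` off `supp g` (the `δᵢ` outside `supp g`), then `T = g^{-j} c`
  lies in any subgroup containing `g` and `c`, and `T` is a 3-cycle.
-/

namespace Literature.GroupTheory.PermutationGroups

open Equiv Equiv.Perm MulAction Subgroup

section algebra

variable {H : Type*} [Group H]

/-- If `a` normalizes `⟨g⟩` then `a g a⁻¹ = g ^ α` for some integer `α`. [folklore] -/
theorem exists_conj_eq_zpow_of_mem_normalizer_zpowers {g a : H}
    (ha : a ∈ normalizer (zpowers g : Set H)) : ∃ α : ℤ, a * g * a⁻¹ = g ^ α := by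
  rw [mem_normalizer_iff] at ha
  obtain ⟨α, hα⟩ := mem_zpowers_iff.mp ((ha g).mp (mem_zpowers g))
  exact ⟨α, hα.symm⟩

/-- **Commutators in `N(⟨g⟩)` centralize `g`.**  If `a, b` normalize the cyclic subgroup `⟨g⟩`,
then `[a, b] = a b a⁻¹ b⁻¹` commutes with `g` (conjugation acts on `⟨g⟩` through the abelian
group of exponents). [folklore] -/
theorem commute_commutator_of_mem_normalizer_zpowers {g a b : H}
    (ha : a ∈ normalizer (zpowers g : Set H)) (hb : b ∈ normalizer (zpowers g : Set H)) :
    Commute (a * b * a⁻¹ * b⁻¹) g := by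
  obtain ⟨α, hα⟩ := exists_conj_eq_zpow_of_mem_normalizer_zpowers ha
  obtain ⟨α', hα'⟩ := exists_conj_eq_zpow_of_mem_normalizer_zpowers (inv_mem ha)
  obtain ⟨β, hβ⟩ := exists_conj_eq_zpow_of_mem_normalizer_zpowers hb
  obtain ⟨β', hβ'⟩ := exists_conj_eq_zpow_of_mem_normalizer_zpowers (inv_mem hb)
  rw [inv_inv] at hα' hβ'
  -- `g ^ (α' * α) = g` and `g ^ (β' * β) = g`
  have hgα : g ^ (α' * α) = g := by
    have e1 : (a⁻¹ * g * a⁻¹⁻¹) ^ α = a⁻¹ * g ^ α * a⁻¹⁻¹ := conj_zpow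
    rw [inv_inv] at e1
    calc g ^ (α' * α) = (g ^ α') ^ α := zpow_mul g α' α
      _ = (a⁻¹ * g * a) ^ α := by rw [hα']
      _ = a⁻¹ * g ^ α * a := e1
      _ = a⁻¹ * (a * g * a⁻¹) * a := by rw [hα]
      _ = g := by group
  have hgβ : g ^ (β' * β) = g := by
    have e1 : (b⁻¹ * g * b⁻¹⁻¹) ^ β = b⁻¹ * g ^ β * b⁻¹⁻¹ := conj_zpow
    rw [inv_inv] at e1
    calc g ^ (β' * β) = (g ^ β') ^ β := zpow_mul g β' β
      _ = (b⁻¹ * g * b) ^ β := by rw [hβ']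
      _ = b⁻¹ * g ^ β * b := e1
      _ = b⁻¹ * (b * g * b⁻¹) * b := by rw [hβ]
      _ = g := by group
  -- conjugating `g` by the commutator multiplies the exponents `α β α' β'`
  have key : (a * b * a⁻¹ * b⁻¹) * g * (a * b * a⁻¹ * b⁻¹)⁻¹ = g := by
    have h1 : b⁻¹ * g * b⁻¹⁻¹ = g ^ β' := by rw [inv_inv]; exact hβ'
    have h2 : a⁻¹ * g ^ β' * a⁻¹⁻¹ = g ^ (α' * β') := by
      rw [← conj_zpow, inv_inv, hα', ← zpow_mul]
    have h3 : b * g ^ (α' * β') * b⁻¹ = g ^ (β * (α' * β')) := by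
      rw [← conj_zpow, hβ, ← zpow_mul]
    have h4 : a * g ^ (β * (α' * β')) * a⁻¹ = g ^ (α * (β * (α' * β'))) := by
      rw [← conj_zpow, hα, ← zpow_mul]
    calc (a * b * a⁻¹ * b⁻¹) * g * (a * b * a⁻¹ * b⁻¹)⁻¹
        = a * (b * (a⁻¹ * (b⁻¹ * g * b⁻¹⁻¹) * a⁻¹⁻¹) * b⁻¹) * a⁻¹ := by group
      _ = g ^ (α * (β * (α' * β'))) := by rw [h1, h2, h3, h4]
      _ = g ^ ((α' * α) * (β' * β)) := by ring_nf
      _ = g := by rw [zpow_mul, hgα, hgβ]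
  change (a * b * a⁻¹ * b⁻¹) * g = g * (a * b * a⁻¹ * b⁻¹)
  calc (a * b * a⁻¹ * b⁻¹) * g
      = ((a * b * a⁻¹ * b⁻¹) * g * (a * b * a⁻¹ * b⁻¹)⁻¹) * (a * b * a⁻¹ * b⁻¹) := by group
    _ = g * (a * b * a⁻¹ * b⁻¹) := by rw [key]

end algebra

section perm

variable {α : Type*} [Fintype α] [DecidableEq α]

/-- An element commuting with a cycle `g` acts on the support of `g` as a power of `g`. [folklore] -/
theorem exists_zpow_eq_on_support_of_commute {g c : Perm α} (hg : g.IsCycle) (hc : Commute c g) :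
    ∃ j : ℤ, ∀ y ∈ g.support, c y = (g ^ j) y := by
  obtain ⟨y₀, hy₀⟩ := hg.nonempty_support
  have hy₀' : g y₀ ≠ y₀ := mem_support.mp hy₀
  -- `c y₀` lies in the support, so it is `g ^ j y₀`
  have hcy₀ : g (c y₀) ≠ c y₀ := by
    intro h
    apply hy₀'
    have : c (g y₀) = c y₀ := by
      rw [show c (g y₀) = g (c y₀) from by
        simpa [Perm.mul_apply] using congrArg (fun e : Perm α => e y₀) hc.eq]
      exact h
    exact c.injective this
  obtain ⟨j, hj⟩ := hg.exists_zpow_eq hy₀' hcy₀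
  refine ⟨j, fun y hy => ?_⟩
  obtain ⟨i, hi⟩ := hg.exists_zpow_eq hy₀' (mem_support.mp hy)
  have hci : Commute c (g ^ i) := hc.zpow_right i
  calc c y = c ((g ^ i) y₀) := by rw [hi]
    _ = (g ^ i) (c y₀) := by
        simpa [Perm.mul_apply] using congrArg (fun e : Perm α => e y₀) hci.eq
    _ = (g ^ i) ((g ^ j) y₀) := by rw [hj]
    _ = (g ^ j) ((g ^ i) y₀) := by
        rw [← Perm.mul_apply, ← Perm.mul_apply, ← zpow_add, ← zpow_add, add_comm]
    _ = (g ^ j) y := by rw [hi]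

/-- **The 3-cycle extraction.**  Let `g` be a cycle and `c` a permutation commuting with `g` which,
off the support of `g`, agrees with `T = (δ₁ δ₂)(δ₁ δ₃)(δ₁ δ₂)(δ₁ δ₃)` for three distinct points
`δᵢ` outside the support.  Then `T = g^{-j} c` for a suitable `j`, so `T` lies in every subgroup
containing `g` and `c`, and `T` is a 3-cycle. [folklore] -/
theorem swap_commutator_mem_of_commute {G : Subgroup (Perm α)} {g c : Perm α} (hg : g.IsCycle)
    (hgG : g ∈ G) (hcG : c ∈ G) (hc : Commute c g) {d₁ d₂ d₃ : α}
    (hd₁ : d₁ ∉ g.support) (hd₂ : d₂ ∉ g.support) (hd₃ : d₃ ∉ g.support)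
    (hagree : ∀ z, z ∉ g.support →
      c z = (swap d₁ d₂ * swap d₁ d₃ * swap d₁ d₂ * swap d₁ d₃) z) :
    swap d₁ d₂ * swap d₁ d₃ * swap d₁ d₂ * swap d₁ d₃ ∈ G := by
  obtain ⟨j, hj⟩ := exists_zpow_eq_on_support_of_commute hg hc
  set T := swap d₁ d₂ * swap d₁ d₃ * swap d₁ d₂ * swap d₁ d₃ with hT
  -- `T` fixes the support of `g` pointwise and preserves its complement
  have hTfix : ∀ y ∈ g.support, T y = y := by
    intro y hy
    have h1 : y ≠ d₁ := fun h => hd₁ (h ▸ hy)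
    have h2 : y ≠ d₂ := fun h => hd₂ (h ▸ hy)
    have h3 : y ≠ d₃ := fun h => hd₃ (h ▸ hy)
    simp [hT, Perm.mul_apply, swap_apply_of_ne_of_ne h1 h2, swap_apply_of_ne_of_ne h1 h3]
  have hTout : ∀ z, z ∉ g.support → T z ∉ g.support := by
    intro z hz hTz
    have := hTfix (T z) hTz
    exact hz (by rwa [T.injective this] at hTz)
  have hkey : T = (g ^ (-j)) * c := by
    ext z
    by_cases hz : z ∈ g.support
    · rw [hTfix z hz, Perm.mul_apply, hj z hz, ← Perm.mul_apply, ← zpow_add, neg_add_cancel,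
        zpow_zero, Perm.one_apply]
    · rw [show ((g ^ (-j)) * c) z = (g ^ (-j)) (c z) from rfl, hagree z hz]
      exact (zpow_apply_eq_self_of_apply_eq_self (notMem_support.mp (hTout z hz)) (-j)).symm
  rw [hkey]
  exact G.mul_mem (G.zpow_mem hgG _) hcG

omit [Fintype α] in
/-- `(δ₁ δ₂)(δ₁ δ₃)(δ₁ δ₂)(δ₁ δ₃)` is the square of the 3-cycle `(δ₁ δ₂)(δ₁ δ₃)`. [folklore] -/
theorem swap_commutator_eq_sq (d₁ d₂ d₃ : α) :
    swap d₁ d₂ * swap d₁ d₃ * swap d₁ d₂ * swap d₁ d₃ =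
      (swap d₁ d₂ * swap d₁ d₃) * (swap d₁ d₂ * swap d₁ d₃) := by
  group

/-- For three distinct points, `(δ₁ δ₂)(δ₁ δ₃)(δ₁ δ₂)(δ₁ δ₃)` is a 3-cycle. [folklore] -/
theorem isThreeCycle_swap_commutator {d₁ d₂ d₃ : α} (h₁₂ : d₁ ≠ d₂) (h₁₃ : d₁ ≠ d₃)
    (h₂₃ : d₂ ≠ d₃) : (swap d₁ d₂ * swap d₁ d₃ * swap d₁ d₂ * swap d₁ d₃).IsThreeCycle := by
  rw [swap_commutator_eq_sq]
  exact (isThreeCycle_swap_mul_swap_same h₁₂ h₁₃ h₂₃).isThreeCycle_sq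

end perm

end Literature.GroupTheory.PermutationGroups
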